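import Mathlib
import HarnessLib
import HarnessLib.Audit
import Summits.ValiantsHypothesis.Statement
import Literature.Computability.AlgebraicComplexity.Elusive
import Literature.Computability.AlgebraicComplexity.RazExplicit
import Literature.Computability.AlgebraicComplexity.RazElusiveGeneralDischarge
import Literature.Computability.AlgebraicComplexity.ValiantConjectureProofs
import HarnessLib.Audit.Status.Attr

/-!
Route: GirthSidon

# Route GirthSidon — girth versus Sidon — B_30 power-sum moment curves in Raz's (m^0.9, 2) regime;
swallowing forces a short additive relation

It suffices to show X = MomentCurveElusive (card girth-vs-sidon-elusive, re-targeted to Raz's actual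
regime): for all large m and
every s with s^10 ≤ m^9 (i.e. s ≤ m^{0.9}), the power-sum ("B_30 moment") monomial curve x ↦
(x^{d(m,i)})_{i<m},
d(m,i) = Σ_{k<60} (i+1)^k · m^{60k} (sixty base-m^60 digits holding the first sixty power sums;
height < m^3600 = poly(m),
digits computable in time poly(log m)), is (s,2)-elusive over ℂ in the sense of Raz 2010 Def. 1.1
(tree `IsElusive`). By Raz 2010,
§1 result 1 (tree named fact `Raz2010_result_1`, taken verbatim as a hypothesis of the Assembly)
applied to the multilinearised curve
(n ≈ 3600·log₂ m variables, m = 2^{Θ(n)} super-polynomial in n, degree < 2^n), X gives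
¬IsPComputable for the permanent over ℂ, hence
VP_ℂ ≠ VNP_ℂ. The route's engine is family-free: swallowing of ANY monomial curve by a quadratic map
with s^10 ≤ m^9 sources should
force a short additive relation among the exponents (crux SwallowForcesShortRelation); the power-sum
exponents have none of length ≤ 30.
Lean: `∃ m₀ : ℕ, ∀ m ≥ m₀, ∀ s : ℕ, s ^ 10 ≤ m ^ 9 →
Literature.Computability.AlgebraicComplexity.IsElusive (fun i : Fin m => (MvPolynomial.X 0 :
MvPolynomial (Fin 1) ℂ) ^ (∑ k ∈ Finset.range 60, ((i : ℕ) + 1) ^ k * m ^ (60 * k))) s 2`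

## Assembly
Bookkeeping over tree theorems (the planner's Check.lean verifies the key identities sorry-free):
with q = ⌊n/36000⌋, m(n) = 2^{10q}, s(n) = 2^{9q}
(so m^9 = s^10 exactly and m(n) ≥ n^c eventually), f n i = Π_{bit_j(d)=1} x_j = `multilinearize n (X
0 ^ d)` has total degree ≤ n and
d < m^3600 = 2^{36000q} ≤ 2^n, so `IsElusive.multilinearize` (Raz Prop. 1.2, proved in
RazElusiveGeneral.lean) transports X to the
multilinearised family; hypothesis 3 is
`Literature.Computability.AlgebraicComplexity.Raz2010_result_1 ℂ` UNFOLDED VERBATIM (a term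
`h : Raz2010_result_1 ℂ` proves it by `h`; kept inline so the route file imports no named-fact
module), giving ¬IsPComputable for
perPoly over ℂ; then `mem_VP_ofFintype_iff_holds` and `perFamily_mem_VNP_holds` (both proved) give
VP ℂ ≠ VNP ℂ = ValiantsHypothesis.
The cruxes feed X through CruxGivesTarget; PolySwallowForcesShortRelation is implied by each of
ranks 2 and 3 (a polynomial
parametrisation is both a pointwise and a formal swallowing), so its refutation kills the line and
its proof is the first milestone.

Rationale: WHY THIS LINE. Raz's programme (Raz2010, abstract and §1 result 1) turns VP ≠ VNP into an
explicit-construction problem: one explicit map eluding all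
images of degree-2 maps ℂ^s → ℂ^m with s ≥ m^{0.9}; route Elusive over-asked s = m−1 and its Sidon
candidate died of ONE 3+3 exponent
coincidence (tree `Summit.ValiantsHypothesis.Elusive.not_elusive_candidate`), and in fact every
monomial curve of height < 2^{m−1}/m²
is swallowed at s = m−1 (support LowMonomialCurvesSwallowed). At s ≤ m^{0.9} the picture flips: for
TORIC (monomial) maps, swallowing
x^d means d lies in the ℚ-column space of a weight-≤2 matrix, whose left kernel is the even-cycle
space of a graph on s vertices with
≥ m − 2s distinct edges, and extremal graph theory (BondySimonovits1974, here in the weak Moore form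
ShortEvenCycle) produces an even cycle of
length ≤ 60, i.e. a balanced relation of ≤ 30 + 30 exponents — impossible for a B_30 set; this half
is provable now (ToricSwallowForcesShortRelation)
and reaches POLYNOMIAL degree, a regime the only printed (m^{0.9},2)-elusiveness proof,
Narayanan2026 Thm 1 (arXiv:2607.15848: doubling curve,
degree 2^{m−1}, sumset expansion + Chebotarev), provably cannot reach (its dimension count needs
height ≥ 2^{~m^{0.8}}; his Rem. 2: degree
2^{m^{o(1)}} would already give VP ≠ VNP). Imported areas: extremal graph theory (girth/even
cycles), additive combinatorics (B_h power-sum codes,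
Vandermonde), valuations/Newton–Puiseux bookkeeping on algebraic curves, and the GMOW
numeric-to-symbolic transfer (GargMakamOliveiraWigderson2019
Prop. 3.3/3.4, PROVED in tree: `GMOW2019_prop33_holds`, `GMOW2019_prop34_holds`) which makes the
general case a statement about formal
Laurent/Puiseux parametrisations; what is genuinely open is isolated as one additive statement about
cancellation (ranks 2–4).

RANKED CRUXES. #0 MomentCurveElusive (target) — X as in § Thesis: for m ≥ m₀ and every s with s^10 ≤
m^9, the B_30 power-sum moment curve (exponents Σ_{k<60}(i+1)^k m^{60k}) is (s,2)-elusive over ℂ.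
(why it might fail: a non-toric quadratic parametrisation by high-degree algebraic functions
cancelling leading terms at 0 AND ∞ in ≥ m − m^0.93 coordinates could reuse m^0.9 variables; nothing
bounds cancellation depth (GMOW §9; Narayanan needs exponential height).) [Raz2010, Narayanan2026,
GargMakamOliveiraWigderson2019, BondySimonovits1974]
#2 SwallowForcesShortRelation (crux) — (family-free cancellation crux, card C1 in additive form) for
m ≥ m₀, every d : Fin m → ℕ and every s with s^10 ≤ m^9: if the monomial curve x ↦ (x^{d_i}) is NOT
(s,2)-elusive over ℂ, then there are multisets S ≠ T over Fin m, each of size ≤ 30, with Σ_S d = Σ_T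
d (degenerate d — repeated or zero exponents — satisfy the conclusion trivially, so no side
conditions). [difficulty: open-problem] (why it might fail: quantifies over ALL exponent sets of any
height: one relation-free set swallowed through leading-term cancellation at both places 0 and ∞ in
all but m^0.93 coordinates refutes it; only the toric and sparse cases are understood.)
[GargMakamOliveiraWigderson2019, Narayanan2026, Raz2010,
Summit.ValiantsHypothesis.Elusive.not_elusive_candidate]
#3 FormalSwallowForcesShortRelation (crux) — (formal version = the general case modulo GMOW Prop 3.3
(proved in tree) and Newton–Puiseux) for m ≥ m₀, d : Fin m → ℕ, s^10 ≤ m^9: if quadratic Γ : Fin m →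
ℂ[y_1..y_s] and formal Laurent series y_j ∈ ℂ((t)) satisfy Γ_i(y) = t^{d_i} for all i, then a
relation S ≠ T, |S|,|T| ≤ 30, Σ_S d = Σ_T d exists. [difficulty: open-problem] (why it might fail:
Laurent series have infinite supports, so support-covering (the sparse engine) is void; cascaded
cancellations in dense series might manufacture m target monomials from m^0.9 series — no bound on
cancellation depth for sparse quadratic systems over ℂ((t)) is on record.)
[GargMakamOliveiraWigderson2019, Raz2010, Narayanan2026]
#4 PolySwallowForcesShortRelation (crux) — (polynomial parametrisations; common special case of
ranks 2 and 3, the kill switch) for m ≥ m₀, d, s^10 ≤ m^9: if quadratic Γ and polynomials y_j ∈ ℂ[x]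
satisfy Γ_i(y_1(x),…,y_s(x)) = x^{d_i} for all i, then a relation S ≠ T of sizes ≤ 30 with equal
d-sums exists. [difficulty: L] (why it might fail: pairwise products of s dense polynomials span
~s²/2 = m^1.8/2 ≫ m dimensions, so linear algebra cannot exclude m monomials in the span; a
structured dense family beyond thin additive bases (which do force relations) may exist.) [Raz2010,
GargMakamOliveiraWigderson2019, Narayanan2026]
#9 ToricSwallowForcesShortRelation (support) — (the provable half, card C3 generalised to signed
exponents) same conclusion when every Γ_i is a monomial c·y^e of degree ≤ 2 and the curve's image
lies in Γ's image pointwise: left-kernel trick (for μ ⊥ rows, x^{⟨μ,d⟩} is constant on ℂ^×, so ⟨μ,d⟩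
= 0), ≤ 2s rows of weight 1 or 2e_j, ≥ m − 2s distinct simple edges on s vertices, ShortEvenCycle
with k = 30 gives an alternating relation of ≤ 30 + 30 exponents. [difficulty: provable-now]
[GargMakamOliveiraWigderson2019, BondySimonovits1974, Narayanan2026]
#9 SparseSwallowForcesShortRelation (support) — (sparse engine) if Γ is any quadratic map and y_j
are Laurent POLYNOMIALS with ≤ B terms each, (sB)^20 ≤ m^19, and Γ_i(y) = x^{d_i} formally, then a
relation of sizes ≤ 30 exists: each x^{d_i} must occur in the support of some y_j·y_k or y_j, so D ⊆
(U+U) ∪ U with |U| ≤ sB+1 ≤ m^0.95+1; covering graph + ShortEvenCycle (k = 30). [difficulty: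
provable-now] [BondySimonovits1974, GargMakamOliveiraWigderson2019]
#9 ShortEvenCycle (support) — (weak Bondy–Simonovits, enough for all uses here) a simple graph on N
≥ 1 vertices with e edges, 4^k N^{k+1} ≤ e^k (i.e. e ≥ 4N^{1+1/k}), k ≥ 1, contains a cycle of even
length ≤ 2k: pass to a bipartite subgraph with ≥ e/2 edges, then to its min-degree ≥ e/(2N) core,
and compare the BFS tree of radius k with N (Moore bound). [difficulty: provable-now]
[BondySimonovits1974, BondyMurty2008]
#9 LowMonomialCurvesSwallowed (support) — (negative knowledge at s = m−1, card C2 = Theorem N of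
card siegel-kills-monomial-elusive-curves; generalises not_elusive_candidate) if m((m−1)D+1) <
2^{m−1} then every monomial curve with exponents in [1,D] is NOT (m−1,2)-elusive: pigeonhole gives μ
∈ {0,±1}^m, ⟨μ,d⟩ = 0, Σμ = 0, μ_m = 0; an even cycle with alternating labels P/N plus private
degree-1 coordinates realises a MONOMIAL quadratic swallower via integer potentials (x ≠ 0) and y =
0 at x = 0. [difficulty: provable-now]
[Summit.ValiantsHypothesis.Elusive.exists_quadratic_swallowing_momentCurve, Narayanan2026,
GargMakamOliveiraWigderson2019]
#9 MomentExponentsRelationFree (support) — (B_30 property of the power-sum code) for m ≥ 60,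
multisets S, T over Fin m of size ≤ 30 with equal sums of Σ_{k<60}(i+1)^k m^{60k} are equal: no
carries (digit k of the sum is Σ_{i∈S}(i+1)^k ≤ 30·m^59 < m^60), so the first 60 power sums of the ≤
60 distinct values agree; Vandermonde (Matrix.det_vandermonde) forces equal multiplicities.
[difficulty: provable-now] [Raz2010, Narayanan2026]
#9 CruxGivesTarget (support) — (glue, five lines; checked sorry-free in the planner's Check.lean)
SwallowForcesShortRelation and MomentExponentsRelationFree imply MomentCurveElusive (take m₀' = max
m₀ 60 and argue by contradiction). [difficulty: provable-now] [Raz2010]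
#9 MomentCurveDefinable (support) — (Raz-explicitness, Def. 1.3, of the multilinearised curve,
indexed by Raz's n with m(n) = 2^{10⌊n/36000⌋}: the i-th coordinate is the multilinear monomial Π_{j
: bit_j(d(m,i)) = 1} x_j, which is `multilinearize n (X 0 ^ d)` by rfl/simp) the family is
poly(n)-definable over ℂ. On paper: Raz's remark after Def. 1.3 (0/1 coefficients computable in time
poly(n) ⇒ definable, via Valiant's criterion). In Lean: guess-and-check Boolean sum over an
arithmetised schoolbook powering circuit (tree: CircuitArithmetization.arith, DefinableVNPWitness
pattern). Heavy; do not start before a crux moves — if it stays too heavy the planner swaps the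
power-sum code for a Boolean-moment code (bits = ANDs of ≤ 5 index bits) whose g is an explicit
product. [difficulty: L] [Raz2010, Burgisser2000]

TWO-LAYER PLAN. Foreseen glued splits (none filed now): SwallowForcesShortRelation ⇐
FormalSwallowForcesShortRelation → PuiseuxTransfer → SwallowForcesShortRelation,
where PuiseuxTransfer = GMOW Prop 3.3 (proved: GMOW2019_prop33_holds) + the embedding of the
algebraic closure of ℂ(x) into Puiseux series
(x = t^N rescales d to N·d; relations scale back). FormalSwallowForcesShortRelation ⇐ HonestPlaces
(after x = t^N and clearing poles, some
normalisation leaves ≥ m^0.94 coordinates whose target valuation at t = 0 or t = ∞ is attained by a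
unique product — no leading cancellation)
→ CoveringGirth (honest coordinates are distinct edges on ≤ 2s+2 valuation values; ShortEvenCycle
with k = 30 needs > 4(2s+2)^{31/30} ≈ m^0.93
of them) → Formal…. PolySwallowForcesShortRelation ⇐ two-ended bookkeeping (order at 0, degree at ∞)
+ Mason–Stothers for the cancelling
coordinates. Each split k ≤ 3, depth 1.

KILL CRITERIA. A counterexample to PolySwallowForcesShortRelation (an explicit quadratic Γ with s^10
≤ m^9 and polynomials y_j with Γ(y) = (x^{d_i}) for a
relation-free d, for infinitely many m) refutes ranks 2, 3, 4 and the mechanism at once: close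
`refuted:PolySwallowForcesShortRelation` and
record the swallowing family as negative knowledge next to LowMonomialCurvesSwallowed. A refutation
of SwallowForcesShortRelation that uses
only pointwise pathologies (non-closed images, the point x = 0) but no formal counterexample ⇒
restate rank 2 with generic containment
(GMOW Rem. 9.4) — pivot, not close. A refutation of MomentCurveElusive alone (family-specific
swallower exploiting digit structure) ⇒ pivot to
another B_30 code (Bose–Chowla / greedy) keeping the cruxes. An explicit (m^0.9,2)-elusive map of
degree 2^{m^{o(1)}} proved elsewhere
(Narayanan's expander programme, Thm 2) moots the route (superseded).
ToricSwallowForcesShortRelation or ShortEvenCycle failing would mean the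
planner's constants are wrong: restate with k, h₀ adjusted (the margins: toric needs only k ≥ 10; we
use 30).

NOT DECOMPOSED YET. The valuation-honesty lemma and its normalisation (which linear change of the
y-variables and which place to use), the Newton–Puiseux
transfer item, Mason–Stothers/ABC counting for cancelling coordinates, the quantitative form of
Raz's conclusion (exponential-type bounds),
robustness upgrades (h = polylog m codes), multivariate monomial maps (Narayanan's expander
matrices) — all layer-2 children or later routes.
Constants (30, 60, 3600, 36000, the factor 4 in ShortEvenCycle) are deliberately generous and not
optimised.

CHEAPEST FALSIFIER. (1) Lookup, done: Narayanan2026 §2–4 and GMOW2019 §9 contain no non-toric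
swallower that reuses variables through cancellation; Narayanan Rem. 1's
swallower and the tree's not_elusive_candidate are toric instances of LowMonomialCurvesSwallowed.
(2) Pencil, done (NOTES.md): the natural
cancelling gadget Γ_i = y_a y_b − y_c y_d over pools x^w(1 + c x^p) cancels at 0 and ∞ but forces D
− p ⊆ W + W, i.e. a covering graph on the
pool shifts, and dies by girth exactly like the toric case; symmetric (Chebyshev-type) pools cannot
produce monomials at all. (3) For a refuter
with kit: m ∈ [9, 14], s = m − 2 (= ⌊m^0.9⌋ there), random B_3 exponent sets ≤ 300: search quadratic
maps with ≤ 2 products per coordinate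
and substitutions y_j = (Laurent monomial)·(1 + c x^p) — a finite combinatorial search; any hit
beyond covering graphs is a candidate
counterexample pattern for PolySwallowForcesShortRelation.

NUMBERS. Raz 2010 §1 result 1: s ≥ m^{0.9}, m ≥ n^{ω(1)}, degree ≤ poly(n) for the multilinearised
map, i.e. curve degree ≤ 2^{m^{o(1)}}; ours: height
< m^3600, n = 36000⌈log₂ m /10⌉. Narayanan2026 Thm 1: (⌊m^{9/10}⌋,2)-elusive at degree 2^{m−1}; his
counting needs |ℓ≤D| > C(s+2ℓ,2ℓ), forcing
ℓ > m^{0.8}/4 and height ≥ (m/ℓ)^ℓ = 2^{Ω(m^{0.8} log m)}. Toric swallowers of a B_k set need s ≳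
m^{k/(k+1)} (k = 10: m^{0.909}; k = 30:
m^{0.968}) against the allowance m^{0.9}. No-go: every monomial curve of height D with m((m−1)D+1) <
2^{m−1} is swallowed at s = m−1 by a
MONOMIAL map. Even cycles: ex(N, C_{2k}) ≤ c_k N^{1+1/k} (BondySimonovits1974); the weak form e ≥
4N^{1+1/k} ⇒ even cycle of length ≤ 2k is
all that is used. B_30 code: 60 digits in base m^60, no carries once m ≥ 31. Items at open: 12 (1
target, 3 cruxes, 7 support, 1 assembly).

DEFINITION REQUESTS. None: `IsElusive`, `polyMapEval` (Elusive.lean), `IsPolyDefinableMap`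
(RazExplicit.lean), `LaurentSeries`, `LaurentPolynomial`,
`SimpleGraph.Walk.IsCycle` exist. Bib keys added this session: Narayanan2026 (arXiv:2607.15848),
BondySimonovits1974.

Novelty: Searches (2026-08-15): `lit read arxiv:2607.15848` (pp. 1–12 read: Thm 1 and its proof, Rem 1–2, Def
2, Lemma 1, Thm 2, Thm 4, §1.7);
`lit search --source crossref "elusive functions lower bounds arithmetic circuits" --year-from 2010`
(15 rows: surveys Saraf 2014
doi:10.1109/ccc.2014.23, Kayal–Saptharishi 2014 — no constructions); `lit search --source
arxiv|openalex|s2 …` rate-limited (HTTP 429) this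
session, zbMATH 0 rows; `lit search --hybrid "elusive polynomial mapping image degree two"` (held:
Landsberg2017 pp. 198–199, BCS1997 — no
candidates); `lit galaxy search "elusive functions and lower bounds for arithmetic circuits" --star
all` (0), `"elusive function" --star pdf`
(10, all noise); `lit frontier ValiantsHypothesis --since 2022` (30 rows, none on elusive maps);
tree: RazElusiveGeneral.lean (result 1
vendored), ElusiveRefutations.lean, Barriers/NumericToSymbolic*.lean (GMOW 3.3/3.4 proved), cards
elusive-digit-curves-valuative-cancellation
(retired into this one) and siegel-kills-monomial-elusive-curves (its Theorem N =
LowMonomialCurvesSwallowed, landed once here).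
Nearest prior art found: Narayanan2026 = arXiv:2607.15848 (Thm 1: doubling curve
(⌊m^{0.9}⌋,2)-elusive against ALL quadratic maps at degree
2^{m−1}; Rem 1: not (m−1,2)-elusive; Rem 2: degree 2^{m^{o(1)}} ⇒ VP ≠ VNP; Thm 2: expander exponent
matrices ⇒ VP ≠ VNP),
GargMakamOliveiraWigderson2019 = arXiv:1904.04299 §9 (Lemma 9.3, Prop 9.8: toric maps with
nonnegative exponents, degree 3^m), Raz2010 (result 1)  [refs: 10.1109/ccc.2014.23, 2607.15848, 1904.04299, arxiv:2607.15848, doi:10.1109/ccc.2014.23, Landsberg2017, Narayanan2026, GargMakamOliveiraWigderson2019, Raz2010]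

Barriers (technique_class: elusive-functions, additive-combinatorics, toric, valuative): - technique_class: elusive-functions, additive-combinatorics, toric, valuative
- Literature.Barriers.ValiantsHypothesis.AlgebraicNaturalProofs: (FSV2018, conditional on succinct
hitting sets) an elusiveness proof certifies non-membership of ONE explicit curve in images of
degree-2 maps on m^0.9 variables; the toric/sparse halves use valuations, supports and girth, not a
VP-constructible distinguisher vanishing on all small circuits; whether a proof of the cancellation
crux can stay non-natural is unknown — honest: not known to evade, not known to be blocked (same
status as route Elusive; Narayanan2026 §1.7 raises the same question).
- Literature.Barriers.ValiantsHypothesis.PartialDerivativesDetPerm: not engaged — no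
partial-derivative or flattening-rank measure appears anywhere in the line; elusiveness against
degree-2 images is certified by additive relations, not by rank.
- Literature.Barriers.ValiantsHypothesis.FullRankMultilinear: not engaged — the multilinearised
curve enters only through Raz's theorem (a hypothesis), no multilinear-formula rank argument is
made.
- Other tree barrier files outside the gate catalogue (RankMethods, RankLiftingBarrier,
CharacteristicTwo, NumericToSymbolicTransfer): rank methods / rank lifting not engaged (no
sub-additive measure; GMOW's transfer GMOW2019_prop33/prop34, proved in tree, is a TOOL for the
foreseen split of rank 2, its char-0 clause met over ℂ); characteristic two irrelevant (Raz's
hypothesis carries ringChar ℂ ≠ 2; everything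

History (route lifecycle, newest last):
- 2026-08-15T16:20:22Z · rev 2: dropped VNPClosedUnderPProjection — route-repair (glue, planner-rbadge-…-GirthSidon-50772ca9-g2-0): DECIDING THEOREM `closes : MomentCurveElusive → MomentCurveDefinable → _root_.ValiantsHypothesis (planner-rbadge-ValiantsHypothesis-GirthSidon-50772ca9-g2-0)
- 2026-08-16T04:20:49Z · AUTO-CRUX (backfill): MomentCurveElusive — hypotheses of the deciding theorem that nothing in the route derives are cruxes (operator:999:1085951)
- 2026-08-25T13:30:38Z · DORMANT — reconciler: no traction for 7.7 d (last activity item-evidence-added at 2026-08-17T19:15:50Z); parked, not closed — `ledger route dormant route-ValiantsHypothes (operator:999:2064039)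
- 2026-08-26T10:54:21Z · REACTIVATED — reconciler: reactivated — activity statement-closed at 2026-08-26T10:17:38Z after parking at 2026-08-25T13:30:38Z (operator:999:2578608)

sub-problem: ValiantsHypothesis · status: open · opened planner-plancard-ValiantsHypothesis-ValiantsH-1e57857b-0 2026-08-15T11:47:59Z · rev 3 · ledger route-ValiantsHypothesis-GirthSidon
GENERATED by the gate from the ledger (D-0016/17). Provers cite these decls: `theorem foo : Summit.ValiantsHypothesis.ValiantsHypothesis.Theses.GirthSidon.<Decl> := …` in Summits/ValiantsHypothesis/ValiantsHypothesis/Theorems/<Name>.lean.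
-/

namespace Summit.ValiantsHypothesis.ValiantsHypothesis.Theses.GirthSidon

open scoped BigOperators Topology Manifold Classical MeasureTheory ProbabilityTheory Matrix InnerProductSpace ComplexConjugate ContinuousMap
open Filter Set Function TopologicalSpace MeasureTheory

attribute [summit_statement] _root_.ValiantsHypothesis

open Literature.PNP

/-- item stmt-ValiantsHypothesis-6534 · crux (kind.auto-crux: conjecture-grade) · rank 0 · open · by planner
why it might fail: a non-toric quadratic parametrisation by high-degree algebraic functions cancelling leading terms at 0 AND ∞ in ≥ m − m^0.93 coordinates could reuse m^0.9 variables; nothing bounds cancellation depth (GMOW §9; Narayanan needs exponential height).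
sources: Raz2010, Narayanan2026, GargMakamOliveiraWigderson2019, BondySimonovits1974
[target] X as in § Thesis: for m ≥ m₀ and every s with s^10 ≤ m^9, the B_30 power-sum moment curve
(exponents Σ_{k<60}(i+1)^k m^{60k}) is (s,2)-elusive over ℂ. -/
@[route_item "route-ValiantsHypothesis-GirthSidon"]
def MomentCurveElusive : Prop :=
  ∃ m₀ : ℕ, ∀ m ≥ m₀, ∀ s : ℕ, s ^ 10 ≤ m ^ 9 → Literature.Computability.AlgebraicComplexity.IsElusive (fun i : Fin m => (MvPolynomial.X 0 : MvPolynomial (Fin 1) ℂ) ^ (∑ k ∈ Finset.range 60, ((i : ℕ) + 1) ^ k * m ^ (60 * k))) s 2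

/-- item stmt-ValiantsHypothesis-6535 · crux · rank 2 · open · by planner
why it might fail: quantifies over ALL exponent sets of any height: one relation-free set swallowed through leading-term cancellation at both places 0 and ∞ in all but m^0.93 coordinates refutes it; only the toric and sparse cases are understood.
sources: GargMakamOliveiraWigderson2019, Narayanan2026, Raz2010, Summit.ValiantsHypothesis.Elusive.not_elusive_candidate
[crux] (family-free cancellation crux, card C1 in additive form) for m ≥ m₀, every d : Fin m → ℕ and
every s with s^10 ≤ m^9: if the monomial curve x ↦ (x^{d_i}) is NOT (s,2)-elusive over ℂ, then there
are multisets S ≠ T over Fin m, each of size ≤ 30, with Σ_S d = Σ_T d (degenerate d — repeated or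
zero exponents — satisfy the conclusion trivially, so no side conditions). [difficulty:
open-problem] -/
@[route_item "route-ValiantsHypothesis-GirthSidon", crux (experiment := "instrument: hands (cycle certificates, mod-8 barriers, relaxed-model bridge landed today); GeneratorObstructions parent 11653 HELD by 11654/11655; Girt…") (source := "director Valiant l.78, 2026-09-01")]
def SwallowForcesShortRelation : Prop :=
  ∃ m₀ : ℕ, ∀ m ≥ m₀, ∀ (d : Fin m → ℕ) (s : ℕ), s ^ 10 ≤ m ^ 9 → ¬ Literature.Computability.AlgebraicComplexity.IsElusive (fun i : Fin m => (MvPolynomial.X 0 : MvPolynomial (Fin 1) ℂ) ^ d i) s 2 → ∃ S T : Multiset (Fin m), S ≠ T ∧ Multiset.card S ≤ 30 ∧ Multiset.card T ≤ 30 ∧ (S.map d).sum = (T.map d).sum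

/-- item stmt-ValiantsHypothesis-6536 · crux · rank 3 · open · by planner
why it might fail: Laurent series have infinite supports, so support-covering (the sparse engine) is void; cascaded cancellations in dense series might manufacture m target monomials from m^0.9 series — no bound on cancellation depth for sparse quadratic systems over ℂ((t)) is on record.
sources: GargMakamOliveiraWigderson2019, Raz2010, Narayanan2026
[crux] (formal version = the general case modulo GMOW Prop 3.3 (proved in tree) and Newton–Puiseux)
for m ≥ m₀, d : Fin m → ℕ, s^10 ≤ m^9: if quadratic Γ : Fin m → ℂ[y_1..y_s] and formal Laurent
series y_j ∈ ℂ((t)) satisfy Γ_i(y) = t^{d_i} for all i, then a relation S ≠ T, |S|,|T| ≤ 30, Σ_S d =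
Σ_T d exists. [difficulty: open-problem] -/
@[route_item "route-ValiantsHypothesis-GirthSidon"]
def FormalSwallowForcesShortRelation : Prop :=
  ∃ m₀ : ℕ, ∀ m ≥ m₀, ∀ (d : Fin m → ℕ) (s : ℕ), s ^ 10 ≤ m ^ 9 → ∀ (Γ : Fin m → MvPolynomial (Fin s) ℂ) (y : Fin s → LaurentSeries ℂ), (∀ i, (Γ i).totalDegree ≤ 2) → (∀ i, MvPolynomial.aeval y (Γ i) = HahnSeries.single (d i : ℤ) (1 : ℂ)) → ∃ S T : Multiset (Fin m), S ≠ T ∧ Multiset.card S ≤ 30 ∧ Multiset.card T ≤ 30 ∧ (S.map d).sum = (T.map d).sum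

/-- item stmt-ValiantsHypothesis-6537 · aside · rank 4 · open · by planner
why it might fail: pairwise products of s dense polynomials span ~s²/2 = m^1.8/2 ≫ m dimensions, so linear algebra cannot exclude m monomials in the span; a structured dense family beyond thin additive bases (which do force relations) may exist.
sources: Raz2010, GargMakamOliveiraWigderson2019, Narayanan2026
[crux] (polynomial parametrisations; common special case of ranks 2 and 3, the kill switch) for m ≥
m₀, d, s^10 ≤ m^9: if quadratic Γ and polynomials y_j ∈ ℂ[x] satisfy Γ_i(y_1(x),…,y_s(x)) = x^{d_i}
for all i, then a relation S ≠ T of sizes ≤ 30 with equal d-sums exists. [difficulty: L] -/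
@[route_item "route-ValiantsHypothesis-GirthSidon"]
def PolySwallowForcesShortRelation : Prop :=
  ∃ m₀ : ℕ, ∀ m ≥ m₀, ∀ (d : Fin m → ℕ) (s : ℕ), s ^ 10 ≤ m ^ 9 → ∀ (Γ : Fin m → MvPolynomial (Fin s) ℂ) (y : Fin s → Polynomial ℂ), (∀ i, (Γ i).totalDegree ≤ 2) → (∀ i, MvPolynomial.aeval y (Γ i) = Polynomial.X ^ d i) → ∃ S T : Multiset (Fin m), S ≠ T ∧ Multiset.card S ≤ 30 ∧ Multiset.card T ≤ 30 ∧ (S.map d).sum = (T.map d).sum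

/-- item stmt-ValiantsHypothesis-21118 · support · rank 9 · closed · proved by Summit.ValiantsHypothesis.ValiantsHypothesis.Theorems.stub_monomialNumericToPuiseux (prover) · by planner
[support] A7 typed Puiseux glue, piece 1 (tenure sweep TABLE §A7, director-valiant g8 16:23:56Z) —
NUMERIC-TO-PUISEUX TRANSFER for monomial curves: if x ↦ (x^{d_i})_{i<m} is not (s,2)-elusive over ℂ
(its image lies in the image of a quadratic Γ : ℂ^s → ℂ^m), then for some N ≥ 1, some quadratic Γ
and Laurent series y ∈ ℂ((t))^s, Γ_i(y) = t^{N·d_i} for every i. PROVABLE NOW, one line: this is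
VERBATIM the statement of the landed theorem
Summit.ValiantsHypothesis.ValiantsHypothesis.Theorems.stub_monomialNumericToPuiseux
(Theorems/GirthSidonMomentCurveElusiveMonomialNumericToPuiseux.lean; GMOW 2019 Lemma 9.3
`exists_aeval_eq_X_pow_of_not_isElusive` + Newton–Puiseux `exists_laurent_relation_transfer`), whose
module imports this route file so no `_holds` link can be rendered — close with `theorem
puiseuxTransfer_proof : PuiseuxTransfer := Theorems.stub_monomialNumericToPuiseux` in a fresh
Theorems file, or `ledger workitem close <this> --as proved --by
Summit.ValiantsHypothesis.ValiantsHypothesis.Theorems.stub_monomialNumericToPuiseux`. Used by the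
glue SwallowOfFormal : FormalSwallowForcesShortRelation → PuiseuxTransfer →
SwallowForcesShortRelation (certified sorry-free in the planner f -/
@[route_item "route-ValiantsHypothesis-GirthSidon"]
def PuiseuxTransfer : Prop :=
  ∀ (m s : ℕ) (d : Fin m → ℕ), ¬ Literature.Computability.AlgebraicComplexity.IsElusive (fun i : Fin m => (MvPolynomial.X 0 : MvPolynomial (Fin 1) ℂ) ^ d i) s 2 → ∃ (N : ℕ) (Γ : Fin m → MvPolynomial (Fin s) ℂ) (y : Fin s → LaurentSeries ℂ), 0 < N ∧ (∀ i, (Γ i).totalDegree ≤ 2) ∧ ∀ i, MvPolynomial.aeval y (Γ i) = HahnSeries.single ((N * d i : ℕ) : ℤ) (1 : ℂ)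

-- `PuiseuxTransfer` holds: proved by `Summit.ValiantsHypothesis.ValiantsHypothesis.Theorems.stub_monomialNumericToPuiseux` (its module imports this route file, so no `_holds` link can be stated here).

/-- item stmt-ValiantsHypothesis-21121 · support · rank 9 · closed · proved by Summit.ValiantsHypothesis.ValiantsHypothesis.Theorems.swallowOfFormal_proof (prover) · by planner
[support] A7 typed Puiseux glue, piece 2 (tenure sweep TABLE §A7: 'FormalSwallowForcesShortRelation
→ PuiseuxTransfer → SwallowForcesShortRelation'; director-valiant g8 16:23:56Z) — the formal crux
(stmt-6536) and the numeric-to-Puiseux transfer (PuiseuxTransfer, provable now) give the numeric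
cancellation crux (stmt-6535, the load-bearing binder of `closes` after the A7 re-glue): given d, s
with s^10 ≤ m^9 and a non-elusive monomial curve, PuiseuxTransfer yields quadratic Γ and Laurent y
with Γ_i(y) = t^{N d_i}, N ≥ 1; apply FormalSwallowForcesShortRelation to the scaled exponents N·d
(same m, s) to get multisets S ≠ T of size ≤ 30 with Σ_S N·d = Σ_T N·d, and cancel N > 0
(Multiset.sum_map_mul_left, Nat.eq_of_mul_eq_mul_left). PROVABLE NOW (~10 lines; certified
sorry-free as an `example` in the planner folder, Sketch_A7.lean rc 0). It registers 6536 as the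
typed sufficient LINE for 6535 (6536 ⟹ 6535; the converse is not claimed: formal Laurent solutions
may exist without numeric ones). Sources: GargMakamOliveiraWigderson2019 Prop 3.3, Raz2010, tree
Theorems/GirthSidonMomentCurveElusiveMonomialNumericToPuiseux. VP≠VNP is not proved by any item
here. -/
@[route_item "route-ValiantsHypothesis-GirthSidon"]
def SwallowOfFormal : Prop :=
  FormalSwallowForcesShortRelation → PuiseuxTransfer → SwallowForcesShortRelation

-- `SwallowOfFormal` holds: proved by `Summit.ValiantsHypothesis.ValiantsHypothesis.Theorems.swallowOfFormal_proof` (its module imports this route file, so no `_holds` link can be stated here).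

/-- item stmt-ValiantsHypothesis-6538 · support · rank 9 · closed · proved by Summit.ValiantsHypothesis.ValiantsHypothesis.Theorems.toricSwallowForcesShortRelation_proof (prover) · by planner
sources: GargMakamOliveiraWigderson2019, BondySimonovits1974, Narayanan2026
[support] (the provable half, card C3 generalised to signed exponents) same conclusion when every
Γ_i is a monomial c·y^e of degree ≤ 2 and the curve's image lies in Γ's image pointwise: left-kernel
trick (for μ ⊥ rows, x^{⟨μ,d⟩} is constant on ℂ^×, so ⟨μ,d⟩ = 0), ≤ 2s rows of weight 1 or 2e_j, ≥ m
− 2s distinct simple edges on s vertices, ShortEvenCycle with k = 30 gives an alternating relation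
of ≤ 30 + 30 exponents. [difficulty: provable-now] -/
@[route_item "route-ValiantsHypothesis-GirthSidon"]
def ToricSwallowForcesShortRelation : Prop :=
  ∃ m₀ : ℕ, ∀ m ≥ m₀, ∀ (d : Fin m → ℕ) (s : ℕ), s ^ 10 ≤ m ^ 9 → ∀ Γ : Fin m → MvPolynomial (Fin s) ℂ, (∀ i, (Γ i).totalDegree ≤ 2) → (∀ i, ∃ (e : Fin s →₀ ℕ) (c : ℂ), Γ i = MvPolynomial.monomial e c) → Set.range (Literature.Computability.AlgebraicComplexity.polyMapEval fun i : Fin m => (MvPolynomial.X 0 : MvPolynomial (Fin 1) ℂ) ^ d i) ⊆ Set.range (Literature.Computability.AlgebraicComplexity.polyMapEval Γ) → ∃ S T : Multiset (Fin m), S ≠ T ∧ Multiset.card S ≤ 30 ∧ Multiset.card T ≤ 30 ∧ (S.map d).sum = (T.map d).sum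

-- `ToricSwallowForcesShortRelation` holds: proved by `Summit.ValiantsHypothesis.ValiantsHypothesis.Theorems.toricSwallowForcesShortRelation_proof` (its module imports this route file, so no `_holds` link can be stated here).

/-- item stmt-ValiantsHypothesis-6539 · support · rank 9 · closed · proved by Summit.ValiantsHypothesis.ValiantsHypothesis.Theorems.sparseSwallowForcesShortRelation_proof @ b26b350acaf3 (prover) · by planner
sources: BondySimonovits1974, GargMakamOliveiraWigderson2019
[support] (sparse engine) if Γ is any quadratic map and y_j are Laurent POLYNOMIALS with ≤ B terms
each, (sB)^20 ≤ m^19, and Γ_i(y) = x^{d_i} formally, then a relation of sizes ≤ 30 exists: each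
x^{d_i} must occur in the support of some y_j·y_k or y_j, so D ⊆ (U+U) ∪ U with |U| ≤ sB+1 ≤
m^0.95+1; covering graph + ShortEvenCycle (k = 30). [difficulty: provable-now] -/
@[route_item "route-ValiantsHypothesis-GirthSidon"]
def SparseSwallowForcesShortRelation : Prop :=
  ∃ m₀ : ℕ, ∀ m ≥ m₀, ∀ (d : Fin m → ℕ) (s B : ℕ), (s * B) ^ 20 ≤ m ^ 19 → ∀ (Γ : Fin m → MvPolynomial (Fin s) ℂ) (y : Fin s → LaurentPolynomial ℂ), (∀ i, (Γ i).totalDegree ≤ 2) → (∀ j, (y j).coeff.support.card ≤ B) → (∀ i, MvPolynomial.aeval y (Γ i) = LaurentPolynomial.T (d i : ℤ)) → ∃ S T : Multiset (Fin m), S ≠ T ∧ Multiset.card S ≤ 30 ∧ Multiset.card T ≤ 30 ∧ (S.map d).sum = (T.map d).sum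

-- `SparseSwallowForcesShortRelation` holds: proved by `Summit.ValiantsHypothesis.ValiantsHypothesis.Theorems.sparseSwallowForcesShortRelation_proof` @ b26b350acaf3 (its module imports this route file, so no `_holds` link can be stated here).

/-- item stmt-ValiantsHypothesis-6540 · support · rank 9 · closed · proved by Summit.ValiantsHypothesis.ValiantsHypothesis.Theorems.shortEvenCycle_proof (prover) · by planner
sources: BondySimonovits1974, BondyMurty2008
[support] (weak Bondy–Simonovits, enough for all uses here) a simple graph on N ≥ 1 vertices with e
edges, 4^k N^{k+1} ≤ e^k (i.e. e ≥ 4N^{1+1/k}), k ≥ 1, contains a cycle of even length ≤ 2k: pass to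
a bipartite subgraph with ≥ e/2 edges, then to its min-degree ≥ e/(2N) core, and compare the BFS
tree of radius k with N (Moore bound). [difficulty: provable-now] -/
@[route_item "route-ValiantsHypothesis-GirthSidon"]
def ShortEvenCycle : Prop :=
  ∀ k N : ℕ, 1 ≤ k → 1 ≤ N → ∀ G : SimpleGraph (Fin N), 4 ^ k * N ^ (k + 1) ≤ G.edgeSet.ncard ^ k → ∃ (u : Fin N) (p : G.Walk u u), p.IsCycle ∧ Even p.length ∧ p.length ≤ 2 * k

-- `ShortEvenCycle` holds: proved by `Summit.ValiantsHypothesis.ValiantsHypothesis.Theorems.shortEvenCycle_proof` (its module imports this route file, so no `_holds` link can be stated here).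

/-- item stmt-ValiantsHypothesis-6541 · support · rank 9 · closed · proved by Summit.ValiantsHypothesis.ValiantsHypothesis.Theorems.LowMonomialCurvesSwallowed_proof @ 292fe237f9c7 (prover) · by planner
sources: Summit.ValiantsHypothesis.Elusive.exists_quadratic_swallowing_momentCurve, Narayanan2026, GargMakamOliveiraWigderson2019
[support] (negative knowledge at s = m−1, card C2 = Theorem N of card
siegel-kills-monomial-elusive-curves; generalises not_elusive_candidate) if m((m−1)D+1) < 2^{m−1}
then every monomial curve with exponents in [1,D] is NOT (m−1,2)-elusive: pigeonhole gives μ ∈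
{0,±1}^m, ⟨μ,d⟩ = 0, Σμ = 0, μ_m = 0; an even cycle with alternating labels P/N plus private
degree-1 coordinates realises a MONOMIAL quadratic swallower via integer potentials (x ≠ 0) and y =
0 at x = 0. [difficulty: provable-now] -/
@[route_item "route-ValiantsHypothesis-GirthSidon"]
def LowMonomialCurvesSwallowed : Prop :=
  ∀ m D : ℕ, m * ((m - 1) * D + 1) < 2 ^ (m - 1) → ∀ d : Fin m → ℕ, (∀ i, 1 ≤ d i ∧ d i ≤ D) → ¬ Literature.Computability.AlgebraicComplexity.IsElusive (fun i : Fin m => (MvPolynomial.X 0 : MvPolynomial (Fin 1) ℂ) ^ d i) (m - 1) 2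

-- `LowMonomialCurvesSwallowed` holds: proved by `Summit.ValiantsHypothesis.ValiantsHypothesis.Theorems.LowMonomialCurvesSwallowed_proof` @ 292fe237f9c7 (its module imports this route file, so no `_holds` link can be stated here).

/-- item stmt-ValiantsHypothesis-6542 · support · rank 9 · closed · proved by Summit.ValiantsHypothesis.ValiantsHypothesis.Theorems.momentExponentsRelationFree_proof (prover) · by planner
sources: Raz2010, Narayanan2026
[support] (B_30 property of the power-sum code) for m ≥ 60, multisets S, T over Fin m of size ≤ 30
with equal sums of Σ_{k<60}(i+1)^k m^{60k} are equal: no carries (digit k of the sum is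
Σ_{i∈S}(i+1)^k ≤ 30·m^59 < m^60), so the first 60 power sums of the ≤ 60 distinct values agree;
Vandermonde (Matrix.det_vandermonde) forces equal multiplicities. [difficulty: provable-now] -/
@[route_item "route-ValiantsHypothesis-GirthSidon", crux]
def MomentExponentsRelationFree : Prop :=
  ∀ m : ℕ, 60 ≤ m → ∀ S T : Multiset (Fin m), Multiset.card S ≤ 30 → Multiset.card T ≤ 30 → (S.map fun i : Fin m => ∑ k ∈ Finset.range 60, ((i : ℕ) + 1) ^ k * m ^ (60 * k)).sum = (T.map fun i : Fin m => ∑ k ∈ Finset.range 60, ((i : ℕ) + 1) ^ k * m ^ (60 * k)).sum → S = T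

-- `MomentExponentsRelationFree` holds: proved by `Summit.ValiantsHypothesis.ValiantsHypothesis.Theorems.momentExponentsRelationFree_proof` (its module imports this route file, so no `_holds` link can be stated here).

/-- item stmt-ValiantsHypothesis-6543 · support · rank 9 · closed · proved by Summit.ValiantsHypothesis.ValiantsHypothesis.Theorems.cruxGivesTarget_proof @ f55395447502 (prover) · by planner
sources: Raz2010
[support] (glue, five lines; checked sorry-free in the planner's Check.lean)
SwallowForcesShortRelation and MomentExponentsRelationFree imply MomentCurveElusive (take m₀' = max
m₀ 60 and argue by contradiction). [difficulty: provable-now] -/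
@[route_item "route-ValiantsHypothesis-GirthSidon", crux]
def CruxGivesTarget : Prop :=
  SwallowForcesShortRelation → MomentExponentsRelationFree → MomentCurveElusive

-- `CruxGivesTarget` holds: proved by `Summit.ValiantsHypothesis.ValiantsHypothesis.Theorems.cruxGivesTarget_proof` @ f55395447502 (its module imports this route file, so no `_holds` link can be stated here).

/-- item stmt-ValiantsHypothesis-6544 · support · rank 9 · closed · proved by Summit.ValiantsHypothesis.ValiantsHypothesis.Theorems.momentCurveDefinable_proof @ 63457b09b2f7 (prover) · by planner
sources: Raz2010, Burgisser2000
[support] (Raz-explicitness, Def. 1.3, of the multilinearised curve, indexed by Raz's n with m(n) =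
2^{10⌊n/36000⌋}: the i-th coordinate is the multilinear monomial Π_{j : bit_j(d(m,i)) = 1} x_j,
which is `multilinearize n (X 0 ^ d)` by rfl/simp) the family is poly(n)-definable over ℂ. On paper:
Raz's remark after Def. 1.3 (0/1 coefficients computable in time poly(n) ⇒ definable, via Valiant's
criterion). In Lean: guess-and-check Boolean sum over an arithmetised schoolbook powering circuit
(tree: CircuitArithmetization.arith, DefinableVNPWitness pattern). Heavy; do not start before a crux
moves — if it stays too heavy the planner swaps the power-sum code for a Boolean-moment code (bits =
ANDs of ≤ 5 index bits) whose g is an explicit product. [difficulty: L] -/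
@[route_item "route-ValiantsHypothesis-GirthSidon", crux]
def MomentCurveDefinable : Prop :=
  Literature.Computability.AlgebraicComplexity.IsPolyDefinableMap (k := ℂ) (m := fun n => 2 ^ (10 * (n / 36000))) (σ := fun n => Fin n) (fun n (i : Fin (2 ^ (10 * (n / 36000)))) => ∏ j : Fin n, (if Nat.testBit (∑ k ∈ Finset.range 60, ((i : ℕ) + 1) ^ k * (2 ^ (10 * (n / 36000))) ^ (60 * k)) j then (MvPolynomial.X j : MvPolynomial (Fin n) ℂ) else 1))

-- `MomentCurveDefinable` holds: proved by `Summit.ValiantsHypothesis.ValiantsHypothesis.Theorems.momentCurveDefinable_proof` @ 63457b09b2f7 (its module imports this route file, so no `_holds` link can be stated here).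

/-- item stmt-ValiantsHypothesis-6545 · assembly · rank 1 · closed · proved by Summit.ValiantsHypothesis.ValiantsHypothesis.Theorems.girthSidon_assembly_proof @ 82479abee689 (prover) · by planner
sources: Raz2010, Burgisser2000, Valiant1979
[assembly] MomentCurveElusive → MomentCurveDefinable → (Raz 2010 §1 result 1 over ℂ, verbatim
`Raz2010_result_1 ℂ`) → ValiantsHypothesis. -/
@[route_item "route-ValiantsHypothesis-GirthSidon"]
def Assembly : Prop :=
  MomentCurveElusive → MomentCurveDefinable → (ringChar ℂ ≠ 2 → ∀ (m s : ℕ → ℕ) (f : ∀ n : ℕ, Fin (m n) → MvPolynomial (Fin n) ℂ), (∀ c : ℕ, ∃ n₀ : ℕ, ∀ n ≥ n₀, n ^ c ≤ m n) → (∃ n₀ : ℕ, ∀ n ≥ n₀, m n ^ 9 ≤ s n ^ 10) → Literature.Computability.AlgebraicComplexity.IsPolyDefinableMap (m := m) (σ := fun n => Fin n) f → Literature.Computability.AlgebraicComplexity.IsPBounded (fun n => Finset.univ.sup fun i : Fin (m n) => (f n i).totalDegree) → (∃ n₀ : ℕ, ∀ n ≥ n₀, Literature.Computability.AlgebraicComplexity.IsElusive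 (f n) (s n) 2) → ¬ Literature.Computability.AlgebraicComplexity.IsPComputable (fun N => Literature.Computability.AlgebraicComplexity.perPoly (Fin N) ℂ)) → ValiantsHypothesis

-- `Assembly` holds: proved by `Summit.ValiantsHypothesis.ValiantsHypothesis.Theorems.girthSidon_assembly_proof` @ 82479abee689 (its module imports this route file, so no `_holds` link can be stated here).

/-! D-0027 §2.1 — DECIDING THEOREM (planner-authored via `route open/edit --closes-file`; by planner-tenure-valiant-dormant-sweep-g1-0 2026-08-27T17:30:39Z):
its hypotheses are this route's items and its conclusion the sub-problem Statement (glue_lint), and it elaborates with this file. -/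

@[closes "route-ValiantsHypothesis-GirthSidon"] theorem closes (h_SwallowForcesShortRelation : SwallowForcesShortRelation)
    (h_MomentExponentsRelationFree : MomentExponentsRelationFree)
    (h_CruxGivesTarget : CruxGivesTarget)
    (h_MomentCurveDefinable : MomentCurveDefinable) : _root_.ValiantsHypothesis := by
  classical
  -- A7 redirect (tenure sweep g1): the target `MomentCurveElusive` (stmt-6534) is DERIVED from the
  -- cancellation crux `SwallowForcesShortRelation` (stmt-6535) and `MomentExponentsRelationFree` ✓ via the
  -- landed glue item `CruxGivesTarget` ✓ (Theorems/GirthSidonCruxGivesTarget.lean); rest verbatim.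
  have h_MomentCurveElusive : MomentCurveElusive :=
    h_CruxGivesTarget h_SwallowForcesShortRelation h_MomentExponentsRelationFree
  -- `ValiantsHypothesis` is `VP ℂ ≠ VNP ℂ`; assume equality and derive that `PER` is p-computable.
  show Literature.Computability.AlgebraicComplexity.VP ℂ ≠
    Literature.Computability.AlgebraicComplexity.VNP ℂ
  intro hEq
  have hVP : Literature.Computability.AlgebraicComplexity.perFamily ℂ ∈
      Literature.Computability.AlgebraicComplexity.VP ℂ := by
    rw [hEq]; exact Literature.Computability.AlgebraicComplexity.perFamily_mem_VNP_holds ℂ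
  have hfam : Literature.Computability.AlgebraicComplexity.IsVPFamily
      (fun n => Literature.Computability.AlgebraicComplexity.perPoly (Fin n) ℂ) :=
    (Literature.Computability.AlgebraicComplexity.mem_VP_ofFintype_iff_holds _).1 hVP
  -- Raz 2010, §1 result 1 (PROVED in tree: `Raz2010_result_1_holds`), applied with
  -- `m(n) = 2^{10⌊n/36000⌋}`, `s(n) = 2^{9⌊n/36000⌋}` and the multilinearised moment curve.
  refine Literature.Computability.AlgebraicComplexity.Raz2010_result_1_holds ℂ ?_
    (fun n => 2 ^ (10 * (n / 36000))) (fun n => 2 ^ (9 * (n / 36000)))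
    (fun n (i : Fin (2 ^ (10 * (n / 36000)))) => ∏ j : Fin n,
      (if Nat.testBit (∑ k ∈ Finset.range 60, ((i : ℕ) + 1) ^ k * (2 ^ (10 * (n / 36000))) ^ (60 * k)) j
        then (MvPolynomial.X j : MvPolynomial (Fin n) ℂ) else 1))
    ?_ ?_ h_MomentCurveDefinable ?_ ?_ hfam.2
  · -- `char ℂ = 0 ≠ 2`
    rw [ringChar.eq_zero]; decide
  · -- `m(n) ≥ n^{ω(1)}`
    intro c
    obtain ⟨T, hT⟩ :=
      Literature.Computability.AlgebraicComplexity.eventually_mul_pow_lt_two_pow c (72000 ^ c)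
    refine ⟨36000 * (T + 1), fun n hn => ?_⟩
    have ht : T ≤ n / 36000 := by omega
    have hn' : n ≤ 72000 * (n / 36000) := by omega
    calc n ^ c ≤ (72000 * (n / 36000)) ^ c := Nat.pow_le_pow_left hn' c
      _ = 72000 ^ c * (n / 36000) ^ c := by rw [mul_pow]
      _ ≤ 2 ^ (n / 36000) := (hT _ ht).le
      _ ≤ 2 ^ (10 * (n / 36000)) := Nat.pow_le_pow_right (by norm_num) (by omega)
  · -- `s(n) ≥ m(n)^{0.9}`: `m^9 = 2^{90q} = s^10`
    exact ⟨0, fun n _ => by rw [← pow_mul, ← pow_mul]; exact le_of_eq (by ring_nf)⟩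
  · -- degree `≤ n` (multilinear in `n` variables)
    exact Literature.Computability.AlgebraicComplexity.IsPBounded.id.mono fun n =>
      Finset.sup_le fun i _ =>
        Literature.Computability.AlgebraicComplexity.totalDegree_multilinMonomial_le (k := ℂ) n _
  · -- eventual `(s(n), 2)`-elusiveness: thesis X at `m = m(n)`, transported along Raz Prop. 1.2
    obtain ⟨m₀, hm₀⟩ := h_MomentCurveElusive
    refine ⟨36000 * (m₀ + 1), fun n hn => ?_⟩
    have hq1 : 1 ≤ n / 36000 := by omega
    have hqm : m₀ < n / 36000 := by omega
    have h36 : 36000 * (n / 36000) ≤ n := Nat.mul_div_le n 36000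
    have hM : m₀ ≤ 2 ^ (10 * (n / 36000)) := by
      have h1 : n / 36000 < 2 ^ (n / 36000) := Nat.lt_two_pow_self
      have h2 : 2 ^ (n / 36000) ≤ 2 ^ (10 * (n / 36000)) :=
        Nat.pow_le_pow_right (by norm_num) (by omega)
      omega
    have hS : (2 ^ (9 * (n / 36000))) ^ 10 ≤ (2 ^ (10 * (n / 36000))) ^ 9 := by
      rw [← pow_mul, ← pow_mul]; exact le_of_eq (by ring_nf)
    have hel := hm₀ (2 ^ (10 * (n / 36000))) hM (2 ^ (9 * (n / 36000))) hS
    -- the exponents are `< m^3600 ≤ 2^n`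
    have hd : ∀ i : Fin (2 ^ (10 * (n / 36000))),
        (∑ k ∈ Finset.range 60, ((i : ℕ) + 1) ^ k * (2 ^ (10 * (n / 36000))) ^ (60 * k)) < 2 ^ n := by
      intro i
      have hi : (i : ℕ) + 1 ≤ 2 ^ (10 * (n / 36000)) := i.2
      have hterm : ∀ k ∈ Finset.range 60,
          ((i : ℕ) + 1) ^ k * (2 ^ (10 * (n / 36000))) ^ (60 * k) ≤ 2 ^ (35990 * (n / 36000)) := by
        intro k hk
        have hk' : k < 60 := Finset.mem_range.1 hk
        calc ((i : ℕ) + 1) ^ k * (2 ^ (10 * (n / 36000))) ^ (60 * k)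
            ≤ (2 ^ (10 * (n / 36000))) ^ k * (2 ^ (10 * (n / 36000))) ^ (60 * k) :=
              Nat.mul_le_mul_right _ (Nat.pow_le_pow_left hi k)
          _ = 2 ^ (10 * (n / 36000) * (k + 60 * k)) := by rw [← pow_add, ← pow_mul]
          _ ≤ 2 ^ (10 * (n / 36000) * 3599) :=
              Nat.pow_le_pow_right (by norm_num) (Nat.mul_le_mul_left _ (by omega))
          _ = 2 ^ (35990 * (n / 36000)) := by ring_nf
      calc (∑ k ∈ Finset.range 60, ((i : ℕ) + 1) ^ k * (2 ^ (10 * (n / 36000))) ^ (60 * k))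
          ≤ ∑ _k ∈ Finset.range 60, 2 ^ (35990 * (n / 36000)) := Finset.sum_le_sum hterm
        _ = 60 * 2 ^ (35990 * (n / 36000)) := by
            rw [Finset.sum_const, Finset.card_range, smul_eq_mul]
        _ < 2 ^ (35990 * (n / 36000) + 6) := by
            have := Nat.two_pow_pos (35990 * (n / 36000))
            rw [pow_add]; omega
        _ ≤ 2 ^ n := Nat.pow_le_pow_right (by norm_num) (by omega)
    -- Prop. 1.2: `Image (x ↦ (x^{d_i})_i) ⊆ Image (multilinearisation)` via `x ↦ (x^{2^j})_j`
    intro Γ hΓ hsub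
    refine hel Γ hΓ (Set.Subset.trans ?_ hsub)
    rintro _ ⟨x, rfl⟩
    refine ⟨fun j => x 0 ^ 2 ^ (j : ℕ), funext fun i => ?_⟩
    have key := Literature.Computability.AlgebraicComplexity.eval_multilinMonomial (k := ℂ) (x 0) (hd i)
    simp only [Literature.Computability.AlgebraicComplexity.polyMapEval_apply, MvPolynomial.eval_pow,
      MvPolynomial.eval_X]
    exact key

end Summit.ValiantsHypothesis.ValiantsHypothesis.Theses.GirthSidon
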